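import Mathlib
import Summits.AtomisticToContinuum.FouriersLaw.Theorems.BondHeatUncertaintyPositiveOrInfiniteLimit
import Summits.AtomisticToContinuum.FouriersLaw.Theses.OddSectorIrreversibility
import Summits.AtomisticToContinuum.FouriersLaw.Theses.JunctionLocality
import Summits.AtomisticToContinuum.FouriersLaw.Theses.BoundaryEscapeDeficit
import Summits.AtomisticToContinuum.FouriersLaw.Theses.BondHeatUncertainty
import Summits.AtomisticToContinuum.FouriersLaw.Theses.FeketeSeriesLaw
import Summits.AtomisticToContinuum.FouriersLaw.Theorems.BondHeatUncertaintyPositiveOrInfiniteLimitSplit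
import Summits.AtomisticToContinuum.FouriersLaw.Theorems.BondHeatUncertaintyPositiveOrInfiniteLimitSlots
import Summits.AtomisticToContinuum.FouriersLaw.Theorems.JunctionLocalitySuperadditiveResistanceStubLinearResponsePlain
import Summits.AtomisticToContinuum.FouriersLaw.Theorems.OddSectorIrreversibilityBoundedResponseConvergesStubPositiveConductance
import Summits.AtomisticToContinuum.FouriersLaw.Theorems.OddSectorIrreversibilityBoundedResponseConvergesStubEscapeNonOscillationOfSuperadditive
import Summits.AtomisticToContinuum.FouriersLaw.Theorems.OddSectorIrreversibilityBoundedResponseConvergesSummableDefectFekete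

/-!
# Crux `BoundedResponseConverges` (stmt-AtomisticToContinuum-9141), line `escape-deficit-dichotomy` —
# the series-law suppliers tolerate any SUMMABLE junction defect (by-name consequences)

Support file for item `stmt-AtomisticToContinuum-9141`
(`Summit.AtomisticToContinuum.FouriersLaw.Theses.OddSectorIrreversibility.BoundedResponseConverges`).

Every series-law supply line of this crux and of its two stubs (`EscapeNonOscillation` 12238,
`ConductanceLowerBound` 11749) landed so far asks for a BOUNDED junction defect:
`R (N+M) ≤ R N + R M + C` (`FeketeSeriesLaw.QuasiSubadditiveResistance`, 14041 ⇒ crux, p97434) or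
`R N + R M − C ≤ R (N+M)` (`JunctionLocality.SuperadditiveResistance`, 11748 ⇒ 12238, p138689), `R N = (N−1)/D N`.
With the summable-defect Fekete lemma of `…SummableDefectFekete.lean` the same conclusions hold for any defect
`φ (N+M)` with `φ ≥ 0` non-decreasing and `∑ₖ φ(2ᵏ)/2ᵏ < ∞` (equivalently `∑ φ(n)/n² < ∞`; e.g. `φ(n) = C·n^θ`,
`θ < 1`, or `C·n/(log n)²`), so that a junction / contact estimate which loses a sublinear-but-summable factor in
the length still closes the corresponding item by name. The hypotheses below are the crux's frame (parameters,
weak-NESS uniqueness, a steady-state family, `T > 0`, response coefficients `D`) followed by such a series law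
(`φ` may depend on everything in the frame); positivity `D N > 0` (`N ≥ 2`) is the landed `positiveConductance_holds`
(stmt-11750), uniqueness the landed `NessUnique_holds`, the response identity the landed `responseIdentity_proof`.

* `positiveOrInfiniteLimit_of_summableDefect_subadditive` (⇒ slot 9128),
* `conductanceLowerBound_of_summableDefect_subadditive` (⇒ stub 2 = 11749),
* `boundedResponseConverges_of_summableDefect_subadditive` (⇒ THE CRUX 9141 — registered helper sub-goal;
  generalises p97434 from a bounded to any summable junction defect),
* `escapeNonOscillation_of_responseRegular` (the canonical-family packaging, once and for all),
* `escapeNonOscillation_of_summableDefect_subadditive` / `escapeNonOscillation_of_summableDefect_superadditive`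
  (⇒ stub 1 = 12238; the latter generalises p138689),
* `boundedResponseConverges_of_quasiSubadditiveResistance'` — the constant case `φ ≡ max C 0` recovers 14041 ⇒ crux.

Nothing here closes item 9141: the summable-defect series laws are hypotheses (weaker than 14041 / 11748, which
are open). No item statement is restated or weakened; all named decls are used verbatim.
-/

noncomputable section

namespace Summit.AtomisticToContinuum.FouriersLaw.Theorems.EscapeDeficitDichotomy

open MeasureTheory Filter Topology Set
open Literature.MathematicalPhysics.KineticTheory.HeatConduction
open Summit.AtomisticToContinuum.FouriersLaw.Theses
open Summit.AtomisticToContinuum.FouriersLaw.Theorems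
open Summit.AtomisticToContinuum.FouriersLaw.Theorems.PositiveOrInfiniteLimit

/-! ## By name: summable-defect series laws ⇒ slot 9128, floor 11749, the crux 9141, non-oscillation 12238

The hypotheses below are the crux's frame (parameters, weak-NESS uniqueness, a steady-state family, `T > 0`,
response coefficients `D`) followed by a series law for `R N = (N−1)/D N` with a summable junction defect `φ`
(which may depend on everything in the frame). With `φ ≡ C` they are `FeketeSeriesLaw.QuasiSubadditiveResistance`
(14041) and `JunctionLocality.SuperadditiveResistance` (11748) respectively, so each theorem below contains the
corresponding landed bounded-defect bridge as the constant case. -/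

/-- **Summable-defect SUBadditive series law ⇒ `PositiveOrInfiniteLimit`** (slot stmt-9128, by name): the
positivity `D N > 0` (`N ≥ 2`) is the landed `positiveConductance_holds` (stmt-11750), and
`ereal_tendsto_of_summableDefect_subadditive_resistance` concludes. Generalises
`positiveOrInfiniteLimit_of_quasiSubadditiveResistance` (bounded defect). [folklore] -/
theorem positiveOrInfiniteLimit_of_summableDefect_subadditive
    (hS : ∀ ω₂ lam β γ : ℝ, 0 < ω₂ → 0 < lam → 0 < β → 0 < γ →
      (∀ (N : ℕ) (T_L T_R : ℝ), 0 < T_L → 0 < T_R →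
        ∀ μ ν : MeasureTheory.Measure (PhaseSpace N),
          (pinnedChain ω₂ lam β γ).IsSteadyState N T_L T_R μ →
          (pinnedChain ω₂ lam β γ).IsSteadyState N T_L T_R ν → μ = ν) →
      ∀ μ : (N : ℕ) → ℝ → ℝ → MeasureTheory.Measure (PhaseSpace N),
        (∀ (N : ℕ) (T_L T_R : ℝ), 0 < T_L → 0 < T_R →
          (pinnedChain ω₂ lam β γ).IsSteadyState N T_L T_R (μ N T_L T_R)) →
        ∀ T : ℝ, 0 < T → ∀ D : ℕ → ℝ,
          (∀ N : ℕ, Tendsto (fun δ : ℝ =>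
              (pinnedChain ω₂ lam β γ).totalCurrent (μ N (T + δ / 2) (T - δ / 2)) / δ)
            (𝓝[≠] 0) (𝓝 (D N))) →
          ∃ φ : ℕ → ℝ, (∀ n, 0 ≤ φ n) ∧ Monotone φ ∧
            Summable (fun k : ℕ => φ (2 ^ k) / ((2 ^ k : ℕ) : ℝ)) ∧
            ∀ N M : ℕ, 2 ≤ N → 2 ≤ M →
              ((N : ℝ) + (M : ℝ) - 1) / D (N + M) ≤ ((N : ℝ) - 1) / D N + ((M : ℝ) - 1) / D M + φ (N + M)) :
    BondHeatUncertainty.PositiveOrInfiniteLimit := by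
  intro ω₂ lam β γ hω hl hβ hγ huniq μ hμ T hT D hD
  have hpos : ∀ N : ℕ, 2 ≤ N → 0 < D N :=
    Summit.AtomisticToContinuum.FouriersLaw.Cruxes.BoundedResponseConverges.TwoScaleGluingLogRigidity.Stubs.positiveConductance_holds
      ω₂ lam β γ hω hl hβ hγ huniq μ hμ T hT D hD
  obtain ⟨φ, hφ0, hφm, hφs, hsub⟩ := hS ω₂ lam β γ hω hl hβ hγ huniq μ hμ T hT D hD
  exact ereal_tendsto_of_summableDefect_subadditive_resistance D φ hφ0 hφm hφs hpos hsub

/-- **Summable-defect subadditive series law ⇒ `ConductanceLowerBound`** (stub 2 of the line = stmt-11749, by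
name), through the landed necessity `conductanceLowerBound_of_positiveOrInfiniteLimit`. [folklore] -/
theorem conductanceLowerBound_of_summableDefect_subadditive
    (hS : ∀ ω₂ lam β γ : ℝ, 0 < ω₂ → 0 < lam → 0 < β → 0 < γ →
      (∀ (N : ℕ) (T_L T_R : ℝ), 0 < T_L → 0 < T_R →
        ∀ μ ν : MeasureTheory.Measure (PhaseSpace N),
          (pinnedChain ω₂ lam β γ).IsSteadyState N T_L T_R μ →
          (pinnedChain ω₂ lam β γ).IsSteadyState N T_L T_R ν → μ = ν) →
      ∀ μ : (N : ℕ) → ℝ → ℝ → MeasureTheory.Measure (PhaseSpace N),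
        (∀ (N : ℕ) (T_L T_R : ℝ), 0 < T_L → 0 < T_R →
          (pinnedChain ω₂ lam β γ).IsSteadyState N T_L T_R (μ N T_L T_R)) →
        ∀ T : ℝ, 0 < T → ∀ D : ℕ → ℝ,
          (∀ N : ℕ, Tendsto (fun δ : ℝ =>
              (pinnedChain ω₂ lam β γ).totalCurrent (μ N (T + δ / 2) (T - δ / 2)) / δ)
            (𝓝[≠] 0) (𝓝 (D N))) →
          ∃ φ : ℕ → ℝ, (∀ n, 0 ≤ φ n) ∧ Monotone φ ∧
            Summable (fun k : ℕ => φ (2 ^ k) / ((2 ^ k : ℕ) : ℝ)) ∧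
            ∀ N M : ℕ, 2 ≤ N → 2 ≤ M →
              ((N : ℝ) + (M : ℝ) - 1) / D (N + M) ≤ ((N : ℝ) - 1) / D N + ((M : ℝ) - 1) / D M + φ (N + M)) :
    JunctionLocality.ConductanceLowerBound :=
  conductanceLowerBound_of_positiveOrInfiniteLimit (positiveOrInfiniteLimit_of_summableDefect_subadditive hS)

/-- **Summable-defect subadditive series law ⇒ THE CRUX `OddSectorIrreversibility.BoundedResponseConverges`**
(stmt-9141, by name): the slot's `EReal` limit `ℓ > 0` is capped by the crux's own `BddAbove (range |D|)`
(landed `boundedResponseConverges_of_positiveOrInfiniteLimit`; the `LocalOhmBV` / `OddSectorIrreversibility` copies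
of the crux are the same proposition). Generalises the landed 14041-bridge
`boundedResponseConverges_of_quasiSubadditiveResistance` (p97434) from a bounded to any summable junction defect.
[folklore] -/
theorem boundedResponseConverges_of_summableDefect_subadditive : (∀ ω₂ lam β γ : ℝ, 0 < ω₂ → 0 < lam → 0 < β → 0 < γ → (∀ (N : ℕ) (T_L T_R : ℝ), 0 < T_L → 0 < T_R → ∀ μ ν : MeasureTheory.Measure (Literature.MathematicalPhysics.KineticTheory.HeatConduction.PhaseSpace N), (Literature.MathematicalPhysics.KineticTheory.HeatConduction.pinnedChain ω₂ lam β γ).IsSteadyState N T_L T_R μ → (Literature.MathematicalPhysics.KineticTheory.HeatConduction.pinnedChain ω₂ lam β γ).IsSteadyState N T_L T_R ν → μ = ν) → ∀ μ : (N : ℕ) → ℝ → ℝ → MeasureTheory.Measure (Literature.MathematicalPhysics.KineticTheory.HeatConduction.PhaseSpace N), (∀ (N : ℕ) (T_L T_R : ℝ), 0 < T_L → 0 < T_R → (Literature.MathematicalPhysics.KineticTheory.HeatConduction.pinnedChain ω₂ lam β γ).IsSteadyState N T_L T_R (μ N T_L T_R)) → ∀ T : ℝ, 0 < T → ∀ D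 : ℕ → ℝ, (∀ N : ℕ, Filter.Tendsto (fun δ : ℝ => (Literature.MathematicalPhysics.KineticTheory.HeatConduction.pinnedChain ω₂ lam β γ).totalCurrent (μ N (T + δ / 2) (T - δ / 2)) / δ) (nhdsWithin 0 {(0 : ℝ)}ᶜ) (nhds (D N))) → ∃ φ : ℕ → ℝ, (∀ n : ℕ, 0 ≤ φ n) ∧ Monotone φ ∧ Summable (fun k : ℕ => φ (2 ^ k) / ((2 ^ k : ℕ) : ℝ)) ∧ ∀ N M : ℕ, 2 ≤ N → 2 ≤ M → ((N : ℝ) + (M : ℝ) - 1) / D (N + M) ≤ ((N : ℝ) - 1) / D N + ((M : ℝ) - 1) / D M + φ (N + M)) → Summit.AtomisticToContinuum.FouriersLaw.Theses.OddSectorIrreversibility.BoundedResponseConverges :=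
  fun hS => boundedResponseConverges_of_positiveOrInfiniteLimit
    (positiveOrInfiniteLimit_of_summableDefect_subadditive hS)

/-- **`EReal`-regularity of the response along every family ⇒ `EscapeNonOscillation`** (stmt-12238, by name) — the
canonical-family packaging once and for all: along the steady-state family given by the landed existence theorem
`pinnedChain_exists_isSteadyState` (junk `0` at non-positive temperatures), the PROVED response identity
(`responseIdentity_proof`, fed with the PROVED `NessUnique_holds`) supplies response coefficients
`D N = (N−1)·γ·E_N` for `N ≥ 1` (`D 0 := 0`, `totalCurrent_zero`); an `EReal` limit of `↑(D N)` is one of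
`↑((N−1)·γ·E_N)`. (The hypothesis is the "regular" half of the landed exact split
`positiveOrInfiniteLimit_iff_conductanceLowerBound_and_regular`.) [folklore] -/
theorem escapeNonOscillation_of_responseRegular
    (hR : ∀ ω₂ lam β γ : ℝ, 0 < ω₂ → 0 < lam → 0 < β → 0 < γ →
      (∀ (N : ℕ) (T_L T_R : ℝ), 0 < T_L → 0 < T_R →
        ∀ μ ν : MeasureTheory.Measure (PhaseSpace N),
          (pinnedChain ω₂ lam β γ).IsSteadyState N T_L T_R μ →
          (pinnedChain ω₂ lam β γ).IsSteadyState N T_L T_R ν → μ = ν) →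
      ∀ μ : (N : ℕ) → ℝ → ℝ → MeasureTheory.Measure (PhaseSpace N),
        (∀ (N : ℕ) (T_L T_R : ℝ), 0 < T_L → 0 < T_R →
          (pinnedChain ω₂ lam β γ).IsSteadyState N T_L T_R (μ N T_L T_R)) →
        ∀ T : ℝ, 0 < T → ∀ D : ℕ → ℝ,
          (∀ N : ℕ, Tendsto (fun δ : ℝ =>
              (pinnedChain ω₂ lam β γ).totalCurrent (μ N (T + δ / 2) (T - δ / 2)) / δ)
            (𝓝[≠] 0) (𝓝 (D N))) →
          ∃ ℓ : EReal, Tendsto (fun N : ℕ => ((D N : ℝ) : EReal)) atTop (𝓝 ℓ)) :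
    BoundaryEscapeDeficit.EscapeNonOscillation := by
  intro ω₂ lam β γ hω hl hβ hγ T hT P K E
  classical
  have huniq := BoundaryEscapeDeficit.NessUnique_holds ω₂ lam β γ hω hl hβ hγ
  -- the canonical steady-state family
  let μ₀ : (N : ℕ) → ℝ → ℝ → MeasureTheory.Measure (PhaseSpace N) := fun N T_L T_R =>
    if h : 0 < T_L ∧ 0 < T_R then
      Classical.choose (pinnedChain_exists_isSteadyState hω hl hβ hγ N h.1 h.2) else 0
  have hμ₀ : ∀ (N : ℕ) (T_L T_R : ℝ), 0 < T_L → 0 < T_R →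
      (pinnedChain ω₂ lam β γ).IsSteadyState N T_L T_R (μ₀ N T_L T_R) := by
    intro N T_L T_R hL' hR'
    simp only [μ₀, dif_pos (And.intro hL' hR')]
    exact Classical.choose_spec (pinnedChain_exists_isSteadyState hω hl hβ hγ N hL' hR')
  have hRI :=
    Summit.AtomisticToContinuum.FouriersLaw.Cruxes.SuperadditiveResistance.ThermaliseThenCutProbeInsertion.responseIdentity_proof
      ω₂ lam β γ hω hl hβ hγ huniq μ₀ hμ₀ T hT
  -- response coefficients along μ₀: the escape expression for `N ≥ 1`, `0` for the empty chain
  let D : ℕ → ℝ := fun N => if N = 0 then 0 else ((N : ℝ) - 1) * γ * E N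
  have hD : ∀ N : ℕ, Tendsto
      (fun δ : ℝ => (pinnedChain ω₂ lam β γ).totalCurrent (μ₀ N (T + δ / 2) (T - δ / 2)) / δ)
      (𝓝[≠] 0) (𝓝 (D N)) := by
    intro N
    rcases Nat.eq_zero_or_pos N with rfl | hN
    · have hD0 : D 0 = 0 := by simp [D]
      rw [hD0]
      simp only [OscillatorChain.totalCurrent_zero, zero_div]
      exact tendsto_const_nhds
    · have hDN : D N = ((N : ℝ) - 1) * γ * E N := by simp [D, hN.ne']
      rw [hDN]
      exact (hRI N hN).2
  obtain ⟨ℓ, hℓ⟩ := hR ω₂ lam β γ hω hl hβ hγ huniq μ₀ hμ₀ T hT D hD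
  refine ⟨ℓ, hℓ.congr' ?_⟩
  filter_upwards [eventually_gt_atTop 0] with N hN
  have hDN : D N = ((N : ℝ) - 1) * γ * E N := by simp [D, hN.ne']
  rw [hDN]

/-- **Summable-defect subadditive series law ⇒ `EscapeNonOscillation`** (stub 1 of the line = stmt-12238, by name):
through the slot and the landed `escapeNonOscillation_of_positiveOrInfiniteLimit`. Generalises the registered
skeleton's map `stub_escapeNonOscillation_of_quasiSubadditiveResistance` (14041, bounded defect). [folklore] -/
theorem escapeNonOscillation_of_summableDefect_subadditive
    (hS : ∀ ω₂ lam β γ : ℝ, 0 < ω₂ → 0 < lam → 0 < β → 0 < γ →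
      (∀ (N : ℕ) (T_L T_R : ℝ), 0 < T_L → 0 < T_R →
        ∀ μ ν : MeasureTheory.Measure (PhaseSpace N),
          (pinnedChain ω₂ lam β γ).IsSteadyState N T_L T_R μ →
          (pinnedChain ω₂ lam β γ).IsSteadyState N T_L T_R ν → μ = ν) →
      ∀ μ : (N : ℕ) → ℝ → ℝ → MeasureTheory.Measure (PhaseSpace N),
        (∀ (N : ℕ) (T_L T_R : ℝ), 0 < T_L → 0 < T_R →
          (pinnedChain ω₂ lam β γ).IsSteadyState N T_L T_R (μ N T_L T_R)) →
        ∀ T : ℝ, 0 < T → ∀ D : ℕ → ℝ,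
          (∀ N : ℕ, Tendsto (fun δ : ℝ =>
              (pinnedChain ω₂ lam β γ).totalCurrent (μ N (T + δ / 2) (T - δ / 2)) / δ)
            (𝓝[≠] 0) (𝓝 (D N))) →
          ∃ φ : ℕ → ℝ, (∀ n, 0 ≤ φ n) ∧ Monotone φ ∧
            Summable (fun k : ℕ => φ (2 ^ k) / ((2 ^ k : ℕ) : ℝ)) ∧
            ∀ N M : ℕ, 2 ≤ N → 2 ≤ M →
              ((N : ℝ) + (M : ℝ) - 1) / D (N + M) ≤ ((N : ℝ) - 1) / D N + ((M : ℝ) - 1) / D M + φ (N + M)) :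
    BoundaryEscapeDeficit.EscapeNonOscillation :=
  escapeNonOscillation_of_positiveOrInfiniteLimit BoundaryEscapeDeficit.NessUnique_holds
    Summit.AtomisticToContinuum.FouriersLaw.Cruxes.SuperadditiveResistance.ThermaliseThenCutProbeInsertion.responseIdentity_proof
    (positiveOrInfiniteLimit_of_summableDefect_subadditive hS)

/-- **Summable-defect SUPERadditive series law ⇒ `EscapeNonOscillation`** (stub 1 of the line = stmt-12238, by
name): `ereal_tendsto_of_summableDefect_superadditive_resistance` gives the `EReal`-regularity of every response
sequence (positivity from the landed `positiveConductance_holds`), and `escapeNonOscillation_of_responseRegular`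
packages it. Generalises the landed 11748-bridge `escapeNonOscillation_of_superadditiveResistance` (p138689) from a
bounded to any summable junction defect. [folklore] -/
theorem escapeNonOscillation_of_summableDefect_superadditive
    (hA : ∀ ω₂ lam β γ : ℝ, 0 < ω₂ → 0 < lam → 0 < β → 0 < γ →
      (∀ (N : ℕ) (T_L T_R : ℝ), 0 < T_L → 0 < T_R →
        ∀ μ ν : MeasureTheory.Measure (PhaseSpace N),
          (pinnedChain ω₂ lam β γ).IsSteadyState N T_L T_R μ →
          (pinnedChain ω₂ lam β γ).IsSteadyState N T_L T_R ν → μ = ν) →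
      ∀ μ : (N : ℕ) → ℝ → ℝ → MeasureTheory.Measure (PhaseSpace N),
        (∀ (N : ℕ) (T_L T_R : ℝ), 0 < T_L → 0 < T_R →
          (pinnedChain ω₂ lam β γ).IsSteadyState N T_L T_R (μ N T_L T_R)) →
        ∀ T : ℝ, 0 < T → ∀ D : ℕ → ℝ,
          (∀ N : ℕ, Tendsto (fun δ : ℝ =>
              (pinnedChain ω₂ lam β γ).totalCurrent (μ N (T + δ / 2) (T - δ / 2)) / δ)
            (𝓝[≠] 0) (𝓝 (D N))) →
          ∃ φ : ℕ → ℝ, (∀ n, 0 ≤ φ n) ∧ Monotone φ ∧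
            Summable (fun k : ℕ => φ (2 ^ k) / ((2 ^ k : ℕ) : ℝ)) ∧
            ∀ N M : ℕ, 2 ≤ N → 2 ≤ M →
              ((N : ℝ) - 1) / D N + ((M : ℝ) - 1) / D M - φ (N + M) ≤ ((N : ℝ) + (M : ℝ) - 1) / D (N + M)) :
    BoundaryEscapeDeficit.EscapeNonOscillation := by
  refine escapeNonOscillation_of_responseRegular ?_
  intro ω₂ lam β γ hω hl hβ hγ huniq μ hμ T hT D hD
  have hpos : ∀ N : ℕ, 2 ≤ N → 0 < D N :=
    Summit.AtomisticToContinuum.FouriersLaw.Cruxes.BoundedResponseConverges.TwoScaleGluingLogRigidity.Stubs.positiveConductance_holds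
      ω₂ lam β γ hω hl hβ hγ huniq μ hμ T hT D hD
  obtain ⟨φ, hφ0, hφm, hφs, hsup⟩ := hA ω₂ lam β γ hω hl hβ hγ huniq μ hμ T hT D hD
  exact ereal_tendsto_of_summableDefect_superadditive_resistance D φ hφ0 hφm hφs hpos hsup

/-- **The constant case recovers the landed bridges**: `QuasiSubadditiveResistance` (14041) is the summable-defect
subadditive law with `φ ≡ max C 0` — so 14041 ⇒ the crux through this file as well (cf. p97434). [folklore] -/
theorem boundedResponseConverges_of_quasiSubadditiveResistance'
    (hS : FeketeSeriesLaw.QuasiSubadditiveResistance) : OddSectorIrreversibility.BoundedResponseConverges := by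
  refine boundedResponseConverges_of_summableDefect_subadditive ?_
  intro ω₂ lam β γ hω hl hβ hγ huniq μ hμ T hT D hD
  obtain ⟨C, hC⟩ := hS ω₂ lam β γ hω hl hβ hγ huniq μ hμ T hT D hD
  refine ⟨fun _ => max C 0, fun _ => le_max_right _ _, fun _ _ _ => le_rfl, ?_, ?_⟩
  · -- `∑ₖ max C 0 / 2ᵏ` is a convergent geometric series
    have h : Summable fun k : ℕ => max C 0 * (1 / 2 : ℝ) ^ k :=
      (summable_geometric_of_lt_one (by norm_num) (by norm_num)).mul_left (max C 0)
    refine h.congr fun k => ?_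
    rw [Nat.cast_pow, Nat.cast_ofNat, one_div, inv_pow, div_eq_mul_inv]
  · intro N M hN hM
    have h := hC N M hN hM
    have h1 : ((N + M - 1 : ℕ) : ℝ) = (N : ℝ) + (M : ℝ) - 1 := by
      rw [Nat.cast_sub (by omega), Nat.cast_add, Nat.cast_one]
    have h2 : ((N - 1 : ℕ) : ℝ) = (N : ℝ) - 1 := by
      rw [Nat.cast_sub (by omega), Nat.cast_one]
    have h3 : ((M - 1 : ℕ) : ℝ) = (M : ℝ) - 1 := by
      rw [Nat.cast_sub (by omega), Nat.cast_one]
    rw [h1, h2, h3] at h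
    linarith [le_max_left C 0]


end Summit.AtomisticToContinuum.FouriersLaw.Theorems.EscapeDeficitDichotomy

end
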